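import Summits.ResolutionOfSingularities.ResolutionOfSingularities.Theorems.FrobeniusLadderFInjectiveMacaulayficationFHalfRowOfProductCentre
import Literature.AlgebraicGeometry.Resolution.BlowupsComposition
import HarnessLib

/-!
# (W-TD) TWO-STOREY GLUE (D-3): a FULL second storey over a product first storey gives the F-half's conclusion for the input floor
# (crux `FInjectiveMacaulayfication` stmt-ResolutionOfSingularities-15315, chain w45a; res-L1-w45a-plan-1 RULING R21.15 (2)(D-3) «`…FDTwoStoreyRow`: S′ = Bl_𝔪̃ ← S₁ = Bl_K̃ S′ ←
# S₂ = Bl_{𝓘_P} S₁ ⇒ by Temkin 2.1.4 ONE blowing up along 𝓚 ≠ ⊥ over the closed point, FULL everywhere ⇒ `f4pos_rowD_twoStorey`»; seat res-L1-w45a-stub-1 g12; GENERIC part, filed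
# ahead of BED D's storey data (D-1 res-L1-w45a-stub-2, D-2 res-L1-w45a-stub-3))

[OURS · L1 W4.5a] Support file (`--supports stmt-ResolutionOfSingularities-15315 --as helper`); def-free; UNCONDITIONAL; no named fact; NOT a statement of any manuscript.
AI-written (AI review is weaker than expert review).

★★ `fHalfConclusion_of_twoStoreys` — the TWO-STOREY form of ✓ `FHalfRowOfProductCentre.fHalfConclusion_of_isBlowup_mul`: `X` integral Noetherian, `x ∈ X`; STOREY 1 a blowing up
`π₁ : X₁ → X` along `Jτ · JK ≠ ⊥` with `Supp Jτ`, `Supp JK` meeting the generizations of `x` only in `x`; STOREY 2 a blowing up `π₂ : X₂ → X₁` along `J′ ≠ ⊥` with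
`π₁(Supp J′)` meeting the generizations of `x` only in `x`; `X₂` FULL at every point over a generization of `x`. THEN for EVERY blowing up `g : S′ → Spec 𝒪_{X,x}` along
`Jτ·𝒪_{X,x}` there is `𝓚 ≠ ⊥` on `S′` supported over the closed point ALL of whose blowings up are FULL at every stalk — the F-half's conclusion for the input floor `Jτ`.
PROOF: Stacks 080B / Temkin 2.1.4 in the explicit form `X₂ → X = Bl_{(Jτ·JK)·R}` with `π₁^{-1}R = J′ · 𝓘_E^d` (`IsBlowup.exists_comap_eq_mul_pow`, `mul_of_isEffectiveCartier`, `comp`);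
re-bracket as `Jτ · (JK·R)`; `Supp R` meets the generizations of `x` only in `x` (off `Supp(Jτ·JK)` the map `π₁` is an isomorphism, lift and use `Supp J′`); non-zero because
`X₂` is integral hence non-empty; then the one-storey lemma. Also `support_generization_of_comp` (the support bookkeeping) as a separate lemma.
[cite: StacksProject, Tag 080B and Tag 080A] [cite: Temkin2008, Lemma 2.1.4] [cite: GortzWedhorn2020, Prop. 13.91]
-/

-- single-problem summit: the doubled namespace component is forced
set_option linter.dupNamespace false

universe u

noncomputable section

namespace Summit.ResolutionOfSingularities.ResolutionOfSingularities.Theorems.FInjectiveMacaulayfication.FHalfRowOfTwoStoreys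

open CategoryTheory CategoryTheory.Limits AlgebraicGeometry TopologicalSpace IsLocalRing
open Literature.AlgebraicGeometry.Resolution
open Summit.ResolutionOfSingularities.ResolutionOfSingularities.Theorems.FInjectiveMacaulayfication
open SliceableCentre GermOfGlobalBlowup

/-- **Support bookkeeping (Stacks 080B, set-theoretic part, relative to a point).** `π₁ : X₁ → X` a blowing up along `P` whose support meets the generizations of `x` only in
`x`; `R` an ideal on `X` with `π₁^{-1} R = J′ · (π₁^{-1}P)^d` where `π₁(Supp J′)` meets the generizations of `x` only in `x`. Then `Supp R` meets the generizations of `x` only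
in `x` (off `Supp P` the map `π₁` is an isomorphism: lift the point). [cite: StacksProject, Tag 080B] -/
theorem support_generization_of_comap_eq {X X₁ : Scheme.{u}} (x : X) {π₁ : X₁ ⟶ X} {P : X.IdealSheafData} (hπ₁ : IsBlowup π₁ P)
    (hsuppP : ∀ y ∈ (P.support : Set X), y ⤳ x → y = x)
    {J' : X₁.IdealSheafData} (hsupp' : ∀ y₁ ∈ (J'.support : Set X₁), π₁.base y₁ ⤳ x → π₁.base y₁ = x)
    {R : X.IdealSheafData} {d : ℕ} (hR : R.comap π₁ = J' * P.comap π₁ ^ d) :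
    ∀ y ∈ (R.support : Set X), y ⤳ x → y = x := by
  intro y hy hyx
  by_cases hyP : y ∈ (P.support : Set X)
  · exact hsuppP y hyP hyx
  -- over the complement of `Supp P`, `π₁` is an isomorphism: lift `y` to `y₁ ∈ X₁`
  let U : X.Opens := ⟨(P.support : Set X)ᶜ, P.support.isClosed.isOpen_compl⟩
  haveI : IsIso (π₁ ∣_ U) := hπ₁.isIso_compl
  obtain ⟨z, hz⟩ := (ConcreteCategory.bijective_of_isIso (π₁ ∣_ U).base).2 ⟨y, hyP⟩
  let y₁ : X₁ := (π₁ ⁻¹ᵁ U).ι z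
  have hy₁ : π₁ y₁ = y := by
    have := morphismRestrict_base_coe π₁ U z
    rw [hz] at this
    exact this.symm
  -- `y₁ ∈ Supp (π₁⁻¹R) = Supp J′ ∪ Supp (π₁⁻¹P)^d`, and `y₁ ∉ Supp π₁⁻¹P`
  have h1 : y₁ ∈ ((R.comap π₁).support : Set X₁) := by
    rw [Scheme.IdealSheafData.support_comap]
    change π₁ y₁ ∈ (R.support : Set X)
    rw [hy₁]
    exact hy
  rw [hR, Scheme.IdealSheafData.support_mul] at h1
  rcases h1 with h1 | h1
  · have := hsupp' y₁ h1 (by rw [show π₁.base y₁ = y from hy₁]; exact hyx)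
    rw [show π₁.base y₁ = y from hy₁] at this
    exact this
  · exfalso
    apply hyP
    rw [← hy₁]
    have h2 : y₁ ∈ ((P.comap π₁).support : Set X₁) := by
      rcases Nat.eq_zero_or_pos d with rfl | hd
      · rw [pow_zero, Scheme.IdealSheafData.one_eq_top, Scheme.IdealSheafData.support_top] at h1
        exact h1.elim
      · rwa [Scheme.IdealSheafData.support_pow _ _ hd.ne'] at h1
    rw [Scheme.IdealSheafData.support_comap] at h2
    exact h2

/-- ★★ **TWO-STOREY GLUE.** See the module docstring: a FULL second storey `X₂ = Bl_{J′} X₁` over a product first storey `X₁ = Bl_{Jτ·JK} X`, both centres over the point `x`,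
gives the F-half's conclusion for EVERY blowing up of `Spec 𝒪_{X,x}` along `Jτ·𝒪_{X,x}` — via Temkin 2.1.4 / Stacks 080B in the explicit form `X₂ = Bl_{Jτ·(JK·R)} X` and the
one-storey lemma `FHalfRowOfProductCentre.fHalfConclusion_of_isBlowup_mul`. [cite: StacksProject, Tag 080B] [cite: Temkin2008, Lemma 2.1.4] [cite: GortzWedhorn2020, Prop. 13.91] -/
theorem fHalfConclusion_of_twoStoreys (p : ℕ) {X X₁ X₂ : Scheme.{0}} [IsIntegral X] [IsNoetherian X] (x : X)
    {π₁ : X₁ ⟶ X} {Jτ JK : X.IdealSheafData} (hπ₁ : IsBlowup π₁ (Jτ * JK)) (hJ : Jτ * JK ≠ ⊥)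
    (hsuppτ : ∀ y ∈ (Jτ.support : Set X), y ⤳ x → y = x) (hsuppK : ∀ y ∈ (JK.support : Set X), y ⤳ x → y = x)
    {π₂ : X₂ ⟶ X₁} {J' : X₁.IdealSheafData} (hπ₂ : IsBlowup π₂ J') (hJ' : J' ≠ ⊥)
    (hsupp' : ∀ y₁ ∈ (J'.support : Set X₁), π₁.base y₁ ⤳ x → π₁.base y₁ = x)
    (hfull : ∀ x₂ : X₂, (π₂ ≫ π₁).base x₂ ⤳ x → FullCl p (X₂.presheaf.stalk x₂)) :
    ∀ (S' : Scheme.{0}) (g : S' ⟶ Spec (X.presheaf.stalk x)), IsBlowup g (Jτ.comap (X.fromSpecStalk x)) →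
      ∃ 𝓚 : S'.IdealSheafData, 𝓚 ≠ ⊥ ∧ (∀ s ∈ (𝓚.support : Set S'), g.base s = closedPoint (X.presheaf.stalk x)) ∧
        ∀ (S'' : Scheme.{0}) (π : S'' ⟶ S'), IsBlowup π 𝓚 → ∀ s : S'', FullCl p (S''.presheaf.stalk s) := by
  -- Stacks 080B, explicit form
  obtain ⟨d, R, hR⟩ := hπ₁.exists_comap_eq_mul_pow J'
  have hπ₂' : IsBlowup π₂ (R.comap π₁) := by
    rw [hR]
    exact hπ₂.mul_of_isEffectiveCartier (hπ₁.isEffectiveCartier.pow d)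
  have hcomp : IsBlowup (π₂ ≫ π₁) (Jτ * (JK * R)) := by
    rw [← mul_assoc]
    exact hπ₁.comp hπ₂'
  -- non-zero: `X₂` is integral, hence non-empty, and a blowing up along `⊥` is empty
  haveI : IsIntegral X₁ := hπ₁.isIntegral hJ
  haveI : IsIntegral X₂ := hπ₂.isIntegral hJ'
  have hQ : Jτ * (JK * R) ≠ ⊥ := by
    intro h0
    rw [h0] at hcomp
    haveI := LocalBlowupDesingularizationDimThree.isEmpty_of_isBlowup_bot hcomp
    obtain ⟨t⟩ := (inferInstance : Nonempty ↥X₂)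
    exact IsEmpty.false t
  -- supports
  have hsuppP : ∀ y ∈ ((Jτ * JK).support : Set X), y ⤳ x → y = x := by
    intro y hy hyx
    rw [Scheme.IdealSheafData.support_mul] at hy
    rcases hy with hy | hy
    · exact hsuppτ y hy hyx
    · exact hsuppK y hy hyx
  have hsuppR := support_generization_of_comap_eq x hπ₁ hsuppP hsupp' hR
  have hsuppKR : ∀ y ∈ ((JK * R).support : Set X), y ⤳ x → y = x := by
    intro y hy hyx
    rw [Scheme.IdealSheafData.support_mul] at hy
    rcases hy with hy | hy
    · exact hsuppK y hy hyx
    · exact hsuppR y hy hyx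
  exact FHalfRowOfProductCentre.fHalfConclusion_of_isBlowup_mul p x hcomp hQ hsuppKR (fun x₂ hx₂ => hfull x₂ hx₂)

end Summit.ResolutionOfSingularities.ResolutionOfSingularities.Theorems.FInjectiveMacaulayfication.FHalfRowOfTwoStoreys

end
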